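import Mathlib
import HarnessLib
import Summits.HubbardSuperconductivity.HubbardSuperconductivity.Theorems.KLProgrammeDefs

/-!
# Route `KLProgramme` — definitions: the sector-counting level function ON THE PERTURBED FERMI CURVE

Cell gate-hubbard-kl, crux K1 `H10TwoPointLimit` (stmt-HubbardSuperconductivity-19938) / K3 child 3; GAP-LEDGER G-002 «closer (i)»,
HOME/prover-p4/PORT-NOTE.md (architecture (β): the free counting lemmas applied at SHIFTED LEVELS with `O(κ)` slack). The tree's
`BandSectorCounting.hfun` (three free curve points) and this lineage's `CountPairsOffset.hfunP` (offset `P` + two free curve points,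
`KLProgrammeDefs.lean`) evaluate the FREE band `ε₂` at the momentum sum. On BGM's moving curve `{ε₀ + δ = μ}` (or the frame curve
`{ε₀ - K = μ}`) the legs are points `p_E(θ) = u(θ)(cos θ, sin θ)` of the perturbed curve — `u` is any selection of its Fermi points
(`IsBandFermiRadius (μ - δ(u θ·dir θ)) θ (u θ)`, files `KLProgrammeH10TwoPointLimitPerturbedFermiRadius*.lean`) — and the level function is
`E = ε₂ + δ` at the sum. This file only NAMES these objects, generically in a radius function `u : ℝ → ℝ` and a perturbation
`δ : (Fin 2 → ℝ) → ℝ` (no hypothesis enters a definition; nothing is proved beyond `rfl`-bookkeeping):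

* `XE u θ = u(θ) cos θ`, `YE u θ = u(θ) sin θ` — the polar curve of `u` (at `u = bandFermiRadius μ` these are the tree's `bandX/bandY`);
* `VXE u θ = u'(θ) cos θ - u(θ) sin θ`, `VYE u θ = u'(θ) sin θ + u(θ) cos θ` — its velocity (`u' = deriv u`; cf. `bandVX/bandVY`);
* `SXE u P θ₂ θ₃ = P₁ + XE u θ₂ + XE u θ₃`, `SYE …` — the momentum sum with offset `P`; `momE u P θ₂ θ₃ = ![SXE, SYE]` as a point of `ℝ²`;
* `hfunE δ u μ P θ₂ θ₃ = ε₂(SXE, SYE) + δ(momE) - μ` — **the perturbed offset level function** (momentum conservation modulo `2πℤ²` is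
  automatic for the `ε₂`-part; for the `δ`-part it is the consumer's periodicity hypothesis on `δ`);
* `h3E δ u P θ₂ θ₃ = 2 sin(SXE)·VXE u θ₃ + 2 sin(SYE)·VYE u θ₃ + Dδ(momE)[(VXE u θ₃, VYE u θ₃)]` — its `∂₃` (that this IS the derivative is
  `hasDerivAt_hfunE_three` in `KLProgrammeH10TwoPointLimitPerturbedCountDeriv.lean`);
* reductions: at `δ = 0`, `u = bandFermiRadius μ` these are `hfunP`, `h3P` (`hfunE_zero_band`, `h3E_zero_band`).

Reference: G. Benfatto, A. Giuliani, V. Mastropietro, Ann. Henri Poincaré 7 (2006) 809–898, Lemma 3.1 / App. A2–A3 (the count is re-run on the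
scale-`h` curve `p_F^{(h)}`, App. A3 p.37).
-/

noncomputable section

namespace Summit.HubbardSuperconductivity.HubbardSuperconductivity.Theorems.PerturbedFermiCurve

set_option linter.dupNamespace false -- summit = problem name (single-conjunct summit), D-0017

open Real Set
open Literature.MathematicalPhysics.QuantumLattice Literature.MathematicalPhysics.QuantumLattice.BandSectorCounting
open Summit.HubbardSuperconductivity.HubbardSuperconductivity.Theorems.CountPairsOffset

/-- `X_E(θ) = u(θ) cos θ`: first coordinate of the polar curve with radius function `u`. -/
def XE (u : ℝ → ℝ) (θ : ℝ) : ℝ := u θ * Real.cos θ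

/-- `Y_E(θ) = u(θ) sin θ`: second coordinate of the polar curve with radius function `u`. -/
def YE (u : ℝ → ℝ) (θ : ℝ) : ℝ := u θ * Real.sin θ

/-- `X_E'(θ) = u'(θ) cos θ - u(θ) sin θ` (with `u' = deriv u`). -/
def VXE (u : ℝ → ℝ) (θ : ℝ) : ℝ := deriv u θ * Real.cos θ - u θ * Real.sin θ

/-- `Y_E'(θ) = u'(θ) sin θ + u(θ) cos θ` (with `u' = deriv u`). -/
def VYE (u : ℝ → ℝ) (θ : ℝ) : ℝ := deriv u θ * Real.sin θ + u θ * Real.cos θ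

/-- `S_x = P₁ + X_E(θ₂) + X_E(θ₃)`: first coordinate of the momentum sum with offset `P`. -/
def SXE (u : ℝ → ℝ) (P : ℝ × ℝ) (θ₂ θ₃ : ℝ) : ℝ := P.1 + XE u θ₂ + XE u θ₃

/-- `S_y = P₂ + Y_E(θ₂) + Y_E(θ₃)`: second coordinate of the momentum sum with offset `P`. -/
def SYE (u : ℝ → ℝ) (P : ℝ × ℝ) (θ₂ θ₃ : ℝ) : ℝ := P.2 + YE u θ₂ + YE u θ₃

/-- The momentum sum `P + p_E(θ₂) + p_E(θ₃)` as a point of `ℝ²` (`Fin 2 → ℝ`, the argument type of `sqDispersion` and of `δ`). -/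
def momE (u : ℝ → ℝ) (P : ℝ × ℝ) (θ₂ θ₃ : ℝ) : Fin 2 → ℝ := ![SXE u P θ₂ θ₃, SYE u P θ₂ θ₃]

/-- **The perturbed offset level function** `h^E_P(θ₂, θ₃) = ε₂(S) + δ(S) - μ`, `S = P + p_E(θ₂) + p_E(θ₃)`: the level function of
the `2n`-leg sector count when the legs run on the perturbed Fermi curve `{ε₀ + δ = μ}` (BGM's scale-`h` curve). -/
def hfunE (δ : (Fin 2 → ℝ) → ℝ) (u : ℝ → ℝ) (μ : ℝ) (P : ℝ × ℝ) (θ₂ θ₃ : ℝ) : ℝ :=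
  eps2 (SXE u P θ₂ θ₃) (SYE u P θ₂ θ₃) + δ (momE u P θ₂ θ₃) - μ

/-- `∂₃ h^E = 2 sin S_x · X_E'(θ₃) + 2 sin S_y · Y_E'(θ₃) + Dδ(S)[p_E'(θ₃)]` (the closed form; `hasDerivAt_hfunE_three` proves it is
the derivative). -/
def h3E (δ : (Fin 2 → ℝ) → ℝ) (u : ℝ → ℝ) (P : ℝ × ℝ) (θ₂ θ₃ : ℝ) : ℝ :=
  2 * Real.sin (SXE u P θ₂ θ₃) * VXE u θ₃ + 2 * Real.sin (SYE u P θ₂ θ₃) * VYE u θ₃ +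
    fderiv ℝ δ (momE u P θ₂ θ₃) ![VXE u θ₃, VYE u θ₃]

/-! ### `rfl`-bookkeeping -/

/-- The inlined form of `h^E`. -/
theorem hfunE_eq (δ : (Fin 2 → ℝ) → ℝ) (u : ℝ → ℝ) (μ : ℝ) (P : ℝ × ℝ) (θ₂ θ₃ : ℝ) :
    hfunE δ u μ P θ₂ θ₃ = eps2 (P.1 + u θ₂ * Real.cos θ₂ + u θ₃ * Real.cos θ₃) (P.2 + u θ₂ * Real.sin θ₂ + u θ₃ * Real.sin θ₃) +
      δ ![P.1 + u θ₂ * Real.cos θ₂ + u θ₃ * Real.cos θ₃, P.2 + u θ₂ * Real.sin θ₂ + u θ₃ * Real.sin θ₃] - μ := rfl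

/-- `h^E` in terms of `sqDispersion` at the momentum sum: `h^E = ε₀(S) + δ(S) - μ`. -/
theorem hfunE_eq_sqDispersion (δ : (Fin 2 → ℝ) → ℝ) (u : ℝ → ℝ) (μ : ℝ) (P : ℝ × ℝ) (θ₂ θ₃ : ℝ) :
    hfunE δ u μ P θ₂ θ₃ = sqDispersion (momE u P θ₂ θ₃) + δ (momE u P θ₂ θ₃) - μ := by
  simp [hfunE, momE, sqDispersion, eps2]

/-- The coordinates of the momentum sum. -/
theorem momE_apply_zero (u : ℝ → ℝ) (P : ℝ × ℝ) (θ₂ θ₃ : ℝ) : momE u P θ₂ θ₃ 0 = SXE u P θ₂ θ₃ := rfl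

/-- The coordinates of the momentum sum. -/
theorem momE_apply_one (u : ℝ → ℝ) (P : ℝ × ℝ) (θ₂ θ₃ : ℝ) : momE u P θ₂ θ₃ 1 = SYE u P θ₂ θ₃ := rfl

/-- Symmetry of `S_x`. -/
theorem SXE_swap (u : ℝ → ℝ) (P : ℝ × ℝ) (θ₂ θ₃ : ℝ) : SXE u P θ₂ θ₃ = SXE u P θ₃ θ₂ := by unfold SXE; ring

/-- Symmetry of `S_y`. -/
theorem SYE_swap (u : ℝ → ℝ) (P : ℝ × ℝ) (θ₂ θ₃ : ℝ) : SYE u P θ₂ θ₃ = SYE u P θ₃ θ₂ := by unfold SYE; ring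

/-- Symmetry of the momentum sum. -/
theorem momE_swap (u : ℝ → ℝ) (P : ℝ × ℝ) (θ₂ θ₃ : ℝ) : momE u P θ₂ θ₃ = momE u P θ₃ θ₂ := by
  unfold momE; rw [SXE_swap, SYE_swap]

/-- Symmetry of `h^E`. -/
theorem hfunE_swap (δ : (Fin 2 → ℝ) → ℝ) (u : ℝ → ℝ) (μ : ℝ) (P : ℝ × ℝ) (θ₂ θ₃ : ℝ) :
    hfunE δ u μ P θ₂ θ₃ = hfunE δ u μ P θ₃ θ₂ := by
  unfold hfunE; rw [SXE_swap, SYE_swap, momE_swap]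

/-- The point `p_E(θ) = u(θ)·dir θ` has coordinates `(X_E θ, Y_E θ)`. -/
theorem smul_dir_eq_XE_YE (u : ℝ → ℝ) (θ : ℝ) : u θ • dir θ = ![XE u θ, YE u θ] := by
  ext i; fin_cases i <;> simp [dir, XE, YE]

/-! ### Reduction to the free objects at `u = bandFermiRadius μ`, `δ = 0` -/

/-- At `u = u_μ` the polar curve is the tree's band curve. -/
theorem XE_band (μ θ : ℝ) : XE (bandFermiRadius μ) θ = bandX μ θ := rfl

/-- At `u = u_μ` the polar curve is the tree's band curve. -/
theorem YE_band (μ θ : ℝ) : YE (bandFermiRadius μ) θ = bandY μ θ := rfl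

/-- At `u = u_μ` (`-4 < μ < 0`) the velocity is the tree's `bandVX`. -/
theorem VXE_band {μ : ℝ} (hμ₁ : -4 < μ) (hμ₂ : μ < 0) (θ : ℝ) : VXE (bandFermiRadius μ) θ = bandVX μ θ := by
  rw [VXE, bandVX, deriv_bandFermiRadius hμ₁ hμ₂ θ]

/-- At `u = u_μ` (`-4 < μ < 0`) the velocity is the tree's `bandVY`. -/
theorem VYE_band {μ : ℝ} (hμ₁ : -4 < μ) (hμ₂ : μ < 0) (θ : ℝ) : VYE (bandFermiRadius μ) θ = bandVY μ θ := by
  rw [VYE, bandVY, deriv_bandFermiRadius hμ₁ hμ₂ θ]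

/-- At `u = u_μ` the momentum sums are the lineage's `SXP/SYP`. -/
theorem SXE_band (μ : ℝ) (P : ℝ × ℝ) (θ₂ θ₃ : ℝ) : SXE (bandFermiRadius μ) P θ₂ θ₃ = SXP μ P θ₂ θ₃ := rfl

/-- At `u = u_μ` the momentum sums are the lineage's `SXP/SYP`. -/
theorem SYE_band (μ : ℝ) (P : ℝ × ℝ) (θ₂ θ₃ : ℝ) : SYE (bandFermiRadius μ) P θ₂ θ₃ = SYP μ P θ₂ θ₃ := rfl

/-- **`δ = 0`, `u = u_μ`: the perturbed level function is the lineage's offset level function `h_P`.** -/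
theorem hfunE_zero_band (μ : ℝ) (P : ℝ × ℝ) (θ₂ θ₃ : ℝ) : hfunE 0 (bandFermiRadius μ) μ P θ₂ θ₃ = hfunP μ P θ₂ θ₃ := by
  simp [hfunE, hfunP, SXE_band, SYE_band]

/-- `δ = 0`, `u = u_μ`: `∂₃ h^E` is the lineage's `h3P`. -/
theorem h3E_zero_band {μ : ℝ} (hμ₁ : -4 < μ) (hμ₂ : μ < 0) (P : ℝ × ℝ) (θ₂ θ₃ : ℝ) :
    h3E 0 (bandFermiRadius μ) P θ₂ θ₃ = h3P μ P θ₂ θ₃ := by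
  simp [h3E, h3P, SXE_band, SYE_band, VXE_band hμ₁ hμ₂, VYE_band hμ₁ hμ₂]

end Summit.HubbardSuperconductivity.HubbardSuperconductivity.Theorems.PerturbedFermiCurve

end
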